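import Summits.KontsevichZagierPeriods.KontsevichZagierPeriods.Theorems.LinRedNormalFormArrangementNormalFormStubRebaseSimpleZeroProductBasic

/-!
# Stub `stub_rebaseSimpleZero`, part `rebaseSimpleZero_product` (crux `ArrangementNormalForm`, line `janus-bands`, v6.2) — `Moves`

The elementary moves on product representations over a one-dimensional base (`RebaseZero.IsProd`)
acting on ONE fibre `i`, the other fibres riding along as spectators:
* `RebaseZero.pull1` — the affine pull-back `tᵢ = μ sᵢ + α y + δ` of the single fibre `i`
  (rule 2; the instance of `RebasePos.pull` with trivial data off `i`), its TERMINAL instance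
  `RebaseZero.good_terminal` (a fibre one of whose bounds is parallel to its letter, or a
  letter-free fibre, is put in format by one pull-back: shear along the letter, rescale the other
  bound to `y` itself) and the reflection `tᵢ ↦ −tᵢ` (`RebaseZero.reflect`);
* `RebaseZero.rowSplit` — cutting the base cell by the sign of an atom (rule 1a, `RebasePos.cutBase`);
* `RebaseZero.fibSplit` — cutting the fibre `i` at an affine level (rule 1a, null level set);
* `RebaseZero.IsProd.addRow` — recording the redundant row `Vᵢ − Uᵢ > 0`.
Registered: `rebaseSimpleZeroProduct_pullC_mk`.

References: M. Kontsevich, D. Zagier, *Periods* (2001), §1.2, rules (1), (2).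
-/

noncomputable section

open Set MeasureTheory MvPolynomial
open Literature.NumberTheory.Transcendental Literature.ModelTheory.ExponentialFields

namespace Summit.KontsevichZagierPeriods.ArrangementNormalForm.JanusBands

namespace RebaseZero

open SeparatePos RebasePos

variable {k : ℕ}

/-! ### The single-fibre pull-back -/

/-- The pulled-back atom in closed form. [folklore] -/
theorem pullC_mk (μ α : ℚ) (δ : (Fin 0 → ℚ) × ℚ) (c : Cf) :
    pullC μ α δ c = mk ((c.1 (Fin.last 0) - α) / μ) ((c.2 - δ.2) / μ) := by
  refine Prod.ext (funext fun j => ?_) ?_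
  · rw [eq_last j]; simp [pullC, mk, Fin.snoc_zero]
  · simp [pullC, mk]

/-- The trivial pull-back is the identity. [folklore] -/
theorem pullC_one : pullC (B := 0) 1 0 0 = id := by
  funext c
  rw [pullC_mk, id, div_one, div_one, sub_zero, Prod.snd_zero, sub_zero, mk_eta]

/-- The reflection pull-back is negation. [folklore] -/
theorem pullC_neg_one : pullC (B := 0) (-1) 0 0 = Neg.neg := by
  funext c
  rw [pullC_mk, sub_zero, Prod.snd_zero, sub_zero, ← mk_eta (-c), neg_fst, Prod.snd_neg]
  congr 1 <;> ring

/-- The scalings of the single-fibre pull-back are non-zero. [folklore] -/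
theorem pullMu_ne_zero (i : Fin k) {μ : ℚ} (hμ : μ ≠ 0) (j : Fin k) : pullMu i μ j ≠ 0 := by
  by_cases hj : j = i
  · subst hj; simpa [pullMu]
  · simp [pullMu, Function.update_of_ne hj]

/-- **The single-fibre affine pull-back** `tᵢ = μ sᵢ + α y + δ` (rule 2): the letter and the
bounds of the fibre `i` are pulled back by `RebasePos.pullC` (bounds swapped if `μ < 0`), the
spectator fibres are untouched, the numerator picks up the constant `RebasePos.pullQ`. -/
theorem pull1 {s : KZ.IntegralRep (0 + 1 + k)} {m' : ℕ} {M : Fin m' → Cf} {U V : Fin k → Cf}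
    {T : BData} {p : MvPolynomial (Fin 0) ℚ} {a : Fin k → Option Cf} (h : IsProd s M U V T p a)
    (i : Fin k) (μ α : ℚ) (δ : (Fin 0 → ℚ) × ℚ) (hμ : μ ≠ 0) :
    ∃ s' : KZ.IntegralRep (0 + 1 + k),
      IsProd s' M (Function.update U i (if 0 < μ then pullC μ α δ (U i) else pullC μ α δ (V i)))
        (Function.update V i (if 0 < μ then pullC μ α δ (V i) else pullC μ α δ (U i))) T
        (C (pullQ (pullMu i μ) a) * p) (Function.update a i ((a i).map (pullC μ α δ))) ∧
      (∀ w, w ∈ s'.domain ↔ pullInv (pullMu i μ) (pullAl i α) (pullDe i δ) w ∈ s.domain) ∧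
      KZ.of s - KZ.of s' ∈ KZ.relations := by
  obtain ⟨s', hmem, -, hdom', hint', hrel⟩ := pull (pullMu i μ) (pullAl i α) (pullDe i δ) s M T.L T.e p T.ℓ₁
    T.ℓ₂ T.n₁ T.n₂ a (fun j => Sum.inr (U j)) (fun j => Sum.inr (V j)) h.bdd h.dom h.int
    (pullMu_ne_zero i hμ) (fun i j hij => by rcases hij with h | h <;> cases h)
  have hi : pullMu i μ i = μ ∧ pullAl i α i = α ∧ pullDe i δ i = δ := by simp [pullMu, pullAl, pullDe]
  have hj : ∀ j, j ≠ i → pullMu i μ j = 1 ∧ pullAl i α j = 0 ∧ pullDe i δ j = 0 := fun j hj => by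
    simp [pullMu, pullAl, pullDe, Function.update_of_ne hj]
  have hlo : pullLo (pullMu i μ) (pullAl i α) (pullDe i δ) (fun j => Sum.inr (U j)) (fun j => Sum.inr (V j)) =
      fun j => Sum.inr (Function.update U i
        (if 0 < μ then pullC μ α δ (U i) else pullC μ α δ (V i)) j) := by
    funext j
    by_cases hji : j = i
    · subst hji
      simp only [pullLo, hi.1, hi.2.1, hi.2.2, Function.update_self]
      split_ifs <;> rfl
    · obtain ⟨h1, h2, h3⟩ := hj j hji
      simp only [pullLo, h1, h2, h3, zero_lt_one, if_true, Sum.map_inr, pullC_one, id,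
        Function.update_of_ne hji]
  have hhi : pullHi (pullMu i μ) (pullAl i α) (pullDe i δ) (fun j => Sum.inr (U j)) (fun j => Sum.inr (V j)) =
      fun j => Sum.inr (Function.update V i
        (if 0 < μ then pullC μ α δ (V i) else pullC μ α δ (U i)) j) := by
    funext j
    by_cases hji : j = i
    · subst hji
      simp only [pullHi, hi.1, hi.2.1, hi.2.2, Function.update_self]
      split_ifs <;> rfl
    · obtain ⟨h1, h2, h3⟩ := hj j hji
      simp only [pullHi, h1, h2, h3, zero_lt_one, if_true, Sum.map_inr, pullC_one, id,
        Function.update_of_ne hji]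
  have ha : pullA (pullMu i μ) (pullAl i α) (pullDe i δ) a = Function.update a i ((a i).map (pullC μ α δ)) := by
    funext j
    by_cases hji : j = i
    · subst hji
      simp only [pullA, hi.1, hi.2.1, hi.2.2, Function.update_self]
    · obtain ⟨h1, h2, h3⟩ := hj j hji
      simp only [pullA, h1, h2, h3, pullC_one, Option.map_id, id, Function.update_of_ne hji]
  refine ⟨s', ⟨?_, ?_, h.adm, h.cbd⟩, hmem, hrel⟩
  · rw [hdom', hlo, hhi]; rfl
  · rw [← ha]; exact hint'

/-- **Terminal move.** If the fibre `i` is letter-free, or one of its bounds is parallel to its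
letter, ONE single-fibre pull-back puts it in format (shear along the letter, rescale the other
bound to the coordinate `y` itself: the product recipe `RebasePos.prodμ/prodα/prodδ` at `i`),
the spectators untouched; so the representation is good as soon as the continuation hypothesis
holds. -/
theorem good_terminal {s : KZ.IntegralRep (0 + 1 + k)} {m' : ℕ} {M : Fin m' → Cf}
    {U V : Fin k → Cf} {T : BData} {p : MvPolynomial (Fin 0) ℚ} {a : Fin k → Option Cf}
    (h : IsProd s M U V T p a) (i : Fin k) (hP : HP T i U V a)
    (hs : ∀ c, a i = some c →
      (U i).1 (Fin.last 0) = c.1 (Fin.last 0) ∨ (V i).1 (Fin.last 0) = c.1 (Fin.last 0)) :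
    Good k (KZ.of s) := by
  have hs' : (U i).1 (Fin.last 0) - prodα a U i = 0 ∨ (V i).1 (Fin.last 0) - prodα a U i = 0 := by
    rcases ha : a i with _ | c
    · exact Or.inl (by simp [prodα, ha])
    · rcases hs c ha with h' | h'
      · exact Or.inl (by simp only [prodα, ha, Option.elim_some, h', sub_self])
      · exact Or.inr (by simp only [prodα, ha, Option.elim_some, h', sub_self])
  obtain ⟨s', h', -, hrel⟩ := pull1 h i (prodμ a U V i) (prodα a U i) (prodδ a U V i)
    (prodμ_ne_zero a U V i)
  refine good_of_sub_mem hrel (hP _ s' M _ _ _ _ h' ⟨fun c hc => ?_, ?_⟩ (same_update i U V a _ _ _))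
  · simp only [Function.update_self] at hc
    rcases ha : a i with _ | c₀
    · simp [ha] at hc
    · rw [ha, Option.map_some, Option.some.injEq] at hc
      rw [← hc, pullC_fst_last]
      simp [prodα, ha]
  · obtain ⟨hu, hv⟩ := prod_bounds a U V i hs'
    simp only [Function.update_self]
    split_ifs
    · exact ⟨hu, hv⟩
    · exact ⟨hv, hu⟩

/-- **Reflection `tᵢ ↦ −tᵢ`** of the fibre `i` (rule 2). -/
theorem reflect {s : KZ.IntegralRep (0 + 1 + k)} {m' : ℕ} {M : Fin m' → Cf} {U V : Fin k → Cf}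
    {T : BData} {p : MvPolynomial (Fin 0) ℚ} {a : Fin k → Option Cf} (h : IsProd s M U V T p a)
    (i : Fin k) : ∃ s' : KZ.IntegralRep (0 + 1 + k),
      IsProd s' M (Function.update U i (-V i)) (Function.update V i (-U i)) T
        (C (pullQ (pullMu i (-1)) a) * p) (Function.update a i ((a i).map Neg.neg)) ∧
      KZ.of s - KZ.of s' ∈ KZ.relations := by
  obtain ⟨s', h', -, hrel⟩ := pull1 h i (-1) 0 0 (by norm_num)
  refine ⟨s', ?_, hrel⟩
  simp only [show ¬ (0 : ℚ) < -1 by norm_num, if_false, pullC_neg_one] at h'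
  exact h'

/-! ### Cuts -/

/-- **Cutting the base cell by the sign of a non-zero atom** (rule 1a, null wall). -/
theorem rowSplit {s : KZ.IntegralRep (0 + 1 + k)} {m' : ℕ} {M : Fin m' → Cf} {U V : Fin k → Cf}
    {T : BData} {p : MvPolynomial (Fin 0) ℚ} {a : Fin k → Option Cf} (h : IsProd s M U V T p a)
    (q : Cf) (hq : q ≠ 0)
    (h₁ : ∀ s₁ : KZ.IntegralRep (0 + 1 + k), IsProd s₁ (Fin.snoc M q : Fin (m' + 1) → Cf) U V T p a →
      Good k (KZ.of s₁))
    (h₂ : ∀ s₂ : KZ.IntegralRep (0 + 1 + k), IsProd s₂ (Fin.snoc M (-q) : Fin (m' + 1) → Cf) U V T p a →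
      Good k (KZ.of s₂)) : Good k (KZ.of s) := by
  obtain ⟨s₁, s₂, hm₁, hm₂, hi₁, hi₂, hd₁, hd₂, hrel⟩ :=
    cutBase s M (fun j => Sum.inr (U j)) (fun j => Sum.inr (V j)) h.dom q hq
  obtain ⟨R, hR⟩ := h.cbd
  have hc : ∀ q' : Cf, ∀ y ∈ cell (Fin.snoc M q' : Fin (m' + 1) → Cf), |y| ≤ R := fun q' y hy =>
    hR y ((mem_cell_snoc M q' y).1 hy).1
  refine good_of_rel3 hrel (h₁ s₁ ⟨hd₁, fun z hz => ?_, h.adm, R, hc q⟩)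
    (h₂ s₂ ⟨hd₂, fun z hz => ?_, h.adm, R, hc (-q)⟩)
  · rw [hi₁]; exact h.int ((hm₁ z).1 hz).1
  · rw [hi₂]; exact h.int ((hm₂ z).1 hz).1

/-- The level set `{tᵢ = θ(y)}` is null. [folklore] -/
theorem volume_tv_eq_ev (i : Fin k) (θ : Cf) :
    volume {z : Fin (0 + 1 + k) → ℝ | tv z i = ev θ (yv z)} = 0 := by
  have h := volume_fibre_eq_affF (b := 0) i θ (K := k)
  simp only [affF_eq] at h
  exact h

/-- **Cutting the fibre `i` at an affine level `θ`** with `Uᵢ ≤ θ ≤ Vᵢ` on the base cell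
(rule 1a, null level set): if both pieces are good, so is the representation. -/
theorem fibSplit {s : KZ.IntegralRep (0 + 1 + k)} {m' : ℕ} {M : Fin m' → Cf} {U V : Fin k → Cf}
    {T : BData} {p : MvPolynomial (Fin 0) ℚ} {a : Fin k → Option Cf} (h : IsProd s M U V T p a)
    (i : Fin k) (θ : Cf) (hθ : ∀ y ∈ cell M, ev (U i) y ≤ ev θ y ∧ ev θ y ≤ ev (V i) y)
    (h₁ : ∀ s₁ : KZ.IntegralRep (0 + 1 + k), IsProd s₁ M U (Function.update V i θ) T p a →
      Good k (KZ.of s₁))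
    (h₂ : ∀ s₂ : KZ.IntegralRep (0 + 1 + k), IsProd s₂ M (Function.update U i θ) V T p a →
      Good k (KZ.of s₂)) : Good k (KZ.of s) := by
  set D₁ := pDom M U (Function.update V i θ) with hD₁
  set D₂ := pDom M (Function.update U i θ) V with hD₂
  have key : ∀ (U' V' : Fin k → Cf) (z : Fin (0 + 1 + k) → ℝ), z ∈ pDom M U' V' ↔
      yv z ∈ cell M ∧ (ev (U' i) (yv z) < tv z i ∧ tv z i < ev (V' i) (yv z)) ∧
        ∀ j, j ≠ i → ev (U' j) (yv z) < tv z j ∧ tv z j < ev (V' j) (yv z) := by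
    intro U' V' z
    rw [mem_pDom]
    refine and_congr_right fun _ => ⟨fun h' => ⟨h' i, fun j _ => h' j⟩, fun h' j => ?_⟩
    by_cases hj : j = i
    · rw [hj]; exact h'.1
    · exact h'.2 j hj
  have hsub₁ : D₁ ⊆ s.domain := fun z hz => by
    rw [h.dom, key]
    rw [hD₁, key] at hz
    obtain ⟨hy, ⟨hz1, hz2⟩, hr⟩ := hz
    simp only [Function.update_self] at hz2
    refine ⟨hy, ⟨hz1, lt_of_lt_of_le hz2 (hθ _ hy).2⟩, fun j hj => ?_⟩
    simpa only [Function.update_of_ne hj] using hr j hj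
  have hsub₂ : D₂ ⊆ s.domain := fun z hz => by
    rw [h.dom, key]
    rw [hD₂, key] at hz
    obtain ⟨hy, ⟨hz1, hz2⟩, hr⟩ := hz
    simp only [Function.update_self] at hz1
    refine ⟨hy, ⟨lt_of_le_of_lt (hθ _ hy).1 hz1, hz2⟩, fun j hj => ?_⟩
    simpa only [Function.update_of_ne hj] using hr j hj
  set s₁ := s.restrict D₁ (isSemialgebraic_pDom _ _ _) hsub₁ with hs₁
  set s₂ := s.restrict D₂ (isSemialgebraic_pDom _ _ _) hsub₂ with hs₂
  have hrel : KZ.of s - KZ.of s₁ - KZ.of s₂ ∈ KZ.relations := by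
    have h0 := KZ.of_sub_sum_of_mem_relations (Finset.univ : Finset (Fin 2)) s ![s₁, s₂]
      (fun j _ => by
        fin_cases j
        · simp [hs₁, sdiff_eq_empty.mpr hsub₁]
        · simp [hs₂, sdiff_eq_empty.mpr hsub₂])
      (fun j _ => by fin_cases j <;> exact fun _ _ => rfl)
      (by
        refine measure_mono_null (fun z hz => ?_) (volume_tv_eq_ev i θ)
        simp only [mem_sdiff, mem_iUnion, Finset.mem_univ, exists_true_left, not_exists,
          Fin.forall_fin_two, Matrix.cons_val_zero, Matrix.cons_val_one] at hz
        obtain ⟨hz, hn₁, hn₂⟩ := hz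
        rw [h.dom, key] at hz
        obtain ⟨hy, ⟨hz1, hz2⟩, hr⟩ := hz
        rcases lt_trichotomy (tv z i) (ev θ (yv z)) with ht | ht | ht
        · refine absurd ?_ hn₁
          show z ∈ D₁
          rw [hD₁, key]
          refine ⟨hy, ⟨hz1, by simpa only [Function.update_self] using ht⟩, fun j hj => ?_⟩
          simpa only [Function.update_of_ne hj] using hr j hj
        · exact ht
        · refine absurd ?_ hn₂
          show z ∈ D₂
          rw [hD₂, key]
          refine ⟨hy, ⟨by simpa only [Function.update_self] using ht, hz2⟩, fun j hj => ?_⟩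
          simpa only [Function.update_of_ne hj] using hr j hj)
      (fun j _ j' _ hjj => by
        have hdisj : D₁ ∩ D₂ = ∅ := Set.eq_empty_of_forall_notMem fun z hz => by
          have hz1 := hz.1; have hz2 := hz.2
          rw [hD₁, key] at hz1
          rw [hD₂, key] at hz2
          have e1 := hz1.2.1.2; have e2 := hz2.2.1.1
          simp only [Function.update_self] at e1 e2
          exact lt_asymm e1 e2
        fin_cases j <;> fin_cases j'
        · exact absurd rfl hjj
        · show volume (D₁ ∩ D₂) = 0
          rw [hdisj, measure_empty]
        · show volume (D₂ ∩ D₁) = 0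
          rw [inter_comm, hdisj, measure_empty]
        · exact absurd rfl hjj)
    rw [Fin.sum_univ_two] at h0
    simpa [sub_sub] using h0
  exact good_of_rel3 hrel (h₁ s₁ (h.restrict _ _ _ hsub₁ Subset.rfl))
    (h₂ s₂ (h.restrict _ _ _ hsub₂ Subset.rfl))

/-- Recording the redundant row `Vᵢ − Uᵢ > 0`. [folklore] -/
theorem IsProd.addRow {s : KZ.IntegralRep (0 + 1 + k)} {m' : ℕ} {M : Fin m' → Cf} {U V : Fin k → Cf}
    {T : BData} {p : MvPolynomial (Fin 0) ℚ} {a : Fin k → Option Cf} (h : IsProd s M U V T p a)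
    (i : Fin k) : IsProd s (Fin.snoc M (V i - U i) : Fin (m' + 1) → Cf) U V T p a := by
  obtain ⟨R, hR⟩ := h.cbd
  refine ⟨?_, h.int, h.adm, R, fun y hy => hR y ((mem_cell_snoc M _ y).1 hy).1⟩
  rw [h.dom]
  ext z
  rw [mem_pDom, mem_pDom, mem_cell_snoc, ev_sub, sub_pos]
  constructor
  · rintro ⟨hy, hf⟩; exact ⟨⟨hy, (hf i).1.trans (hf i).2⟩, hf⟩
  · rintro ⟨⟨hy, -⟩, hf⟩; exact ⟨hy, hf⟩

end RebaseZero

/-- Registered support goal of this file: the pulled-back atom of the literal text over a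
one-dimensional base in closed form. -/
theorem rebaseSimpleZeroProduct_pullC_mk (μ α : ℚ) (δ : (Fin 0 → ℚ) × ℚ) (c : (Fin (0 + 1) → ℚ) × ℚ) : RebasePos.pullC μ α δ c = RebaseZero.mk ((c.1 (Fin.last 0) - α) / μ) ((c.2 - δ.2) / μ) :=
  RebaseZero.pullC_mk μ α δ c

end Summit.KontsevichZagierPeriods.ArrangementNormalForm.JanusBands
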